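/-
Origin: expansion seat `planner-pub-hodgecm-qw8b-g6-0`, handover #2 2026-08-18T11:05:57Z (window to 11:13:56Z) (`HOME/pub-hodgecm-qw8b-g6/lean/Qw8b6/EndStateHCCMNoN3.lean`, md5 c830be8a, 116 lines);
landed by the gen-7 packager in gate run 28 as `HodgeCM/PerL34/EndStateHCCMNoN3.lean` (import ^import Qw8b6\.Qw8NoN3\b→import HodgeCM.StubTree.Qw8NoN3 ×1).
-/
/-
Copyright: pub-hodgecm formalisation cell (harness21, 2026). New file (not vendored).
Origin: HOME/pub-hodgecm-qw8b-g6/lean/Qw8b6/EndStateHCCMNoN3.lean — session planner-pub-hodgecm-qw8b-g6-0 (unit pub-hodgecm-qw8b-g6,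
QW8 SEAT 2, part (6b)(ii), generation 6), second file.  WIP module `Qw8b6.EndStateHCCMNoN3`; intended final place
`HodgeCM/PerL34/EndStateHCCMNoN3.lean` (module `HodgeCM.PerL34.EndStateHCCMNoN3`).  ADDITIVE LEAF: replaces nothing, nothing
imports it.  Imports: the landed `HodgeCM.PerL34.EndStateHCCMNoN4` (qw8b-g5, gate run 27) and this seat's first file under its WIP
name `Qw8b6.Qw8NoN3` (HANDOVER #1, ↦ `HodgeCM.StubTree.Qw8NoN3`; ONE import line to rewrite); lands AFTER it.
-/
import Summits.HodgeConjecture.HodgeCM.PerL34.EndStateHCCMNoN4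
import Summits.HodgeConjecture.HodgeCM.StubTree.Qw8NoN3

/-!
# `HC_CM` end to end with the [QW8] side WITHOUT N3 (and without N4), route (δ)

`HodgeCM.PerL34.EndStateHCCMNoN4` (qw8b-g5, run 27) composes the PerL-side end state (`EndStateShadow.EndState T Pc`: the
thirteen binders of `AssemblyRoutes.perL_of_openCharsWeilLeavesCRΔ`) with the [QW8] side through
`Assembly.COR_CM_of_descentFactsB₃` — eight [QW8]-side facts on route (δ): N1, N2, N3, F4, F5, F-H0, F7d-B, M40.  By
`HodgeCM.StubTree.Qw8NoN3` (this seat's first file) N3 `Fact_pull_H0` is not an input on route (δ)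
(`Assembly.COR_CM_of_descentFactsB₄`: its CM-product instance follows from F-H0), so the end-to-end statements hold with the
SEVEN-fact list N1 `Fact_cupExterior`, N2 `Fact_cup_hodge`, F4 `Fact_cupAlg`, F5 `Fact_cupAssoc`, F-H0 `Fact_unitH0`, F7d-B
`Fact_gysinDescentB`, M40 `Fact_dimProd`:

* `hcCM_of_endState_descentFactsB₄ (M) (E) (hN1 hN2 h4 h5 hu hb hd) : U.HC_CM` (route (δ), no N3, no N4);
* `hcCM_of_endState_descentFacts₄ (M) (E) (hN1 hN2 h3 h4 h5 h7d hd) : U.HC_CM` (route (γ), N3 weakened to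
  `Fact_pull_H0_cmProd`);
* `endToEndB₄ (M) (E) (hN1 hN2 h4 h5 hu hb hd) : U.HC_CM ∧ U.PerL44 ∧ U.PerL ∧ U.PeriodThmF ∧ U.W_RK4`;
* `hcCM_of_openCharsWeilLeavesCRΔ_descentFactsB₄` — binders explicit: `M` + 13 (PerL side) + 7 ([QW8] side, route (δ));
  run 27's explicit form `hcCM_of_openCharsWeilLeavesCRΔ_descentFacts₃` had `M` + 13 + 7 on route (γ) WITH N3, run 26's
  `hcCM_of_openCharsWeilLeavesCRΔ_descentFacts` `M` + 13 + 8.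

The proofs are those of `EndStateHCCMNoN4` verbatim with `COR_CM_of_descentFactsB₄` / `COR_CM_of_descentFacts₄`.  Nothing
cited, nothing posited; Mathlib + the package only.
-/

set_option autoImplicit false

noncomputable section

open HodgeCM.Prior.Perl34File HodgeCM.Prior.Perl34File.Perl34 HodgeCM.PerL34.ArchC

namespace HodgeCM

namespace PerL34

namespace EndStateHCCM

open Universe Universe.ThetaModel AssemblyRoutes EndStateShadow EndStateThm44 CharSpansFinal

variable {U : Universe} {T : U.ThetaModel}
variable {Pc : ∀ {L : CMField} {ι₁ : L →+* ℂ} (V : HermSpace3 L ι₁) (c : SeesawCtx L),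
  C4a.PointedCore (T.core V c)}

/-- **`HC_CM` END TO END without N3 and N4, route (δ).**  Model axioms + the PerL-side end state + the [QW8]-side list N1
`Fact_cupExterior`, N2 `Fact_cup_hodge`, F4 `Fact_cupAlg`, F5 `Fact_cupAssoc`, F-H0 `Fact_unitH0`, F7d-B `Fact_gysinDescentB`,
M40 `Fact_dimProd` (compare `hcCM_of_endState_descentFactsB₃`: `hN3` deleted). -/
theorem hcCM_of_endState_descentFactsB₄ (M : U.ModelAxioms) (E : EndState T Pc)
    (hN1 : U.Fact_cupExterior) (hN2 : U.Fact_cup_hodge) (h4 : U.Fact_cupAlg) (h5 : U.Fact_cupAssoc)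
    (hu : U.Fact_unitH0) (hb : U.Fact_gysinDescentB) (hd : U.Fact_dimProd) : U.HC_CM :=
  Assembly.COR_CM_of_descentFactsB₄ U M (E.realisationExists M).2 hN1 hN2 h4 h5 hu hb hd

/-- The same on route (γ) = F7d, with N3 weakened to its CM-product instance `Fact_pull_H0_cmProd`: N1, N2,
`Fact_pull_H0_cmProd`, F4, F5, F7d `Fact_gysinDescent`, M40 (compare `hcCM_of_endState_descentFacts₃`). -/
theorem hcCM_of_endState_descentFacts₄ (M : U.ModelAxioms) (E : EndState T Pc)
    (hN1 : U.Fact_cupExterior) (hN2 : U.Fact_cup_hodge) (h3 : U.Fact_pull_H0_cmProd)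
    (h4 : U.Fact_cupAlg) (h5 : U.Fact_cupAssoc) (h7d : U.Fact_gysinDescent) (hd : U.Fact_dimProd) : U.HC_CM :=
  Assembly.COR_CM_of_descentFacts₄ U M (E.realisationExists M).2 hN1 hN2 h3 h4 h5 h7d hd

/-- **Every conclusion of record at once** from the two end states, [QW8] side on route (δ) without N3, N4: `HC_CM`,
`PerL44`, `PerL`, the period theorem face F and `W_RK4` (compare `endToEnd₃`). -/
theorem endToEndB₄ (M : U.ModelAxioms) (E : EndState T Pc)
    (hN1 : U.Fact_cupExterior) (hN2 : U.Fact_cup_hodge) (h4 : U.Fact_cupAlg) (h5 : U.Fact_cupAssoc)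
    (hu : U.Fact_unitH0) (hb : U.Fact_gysinDescentB) (hd : U.Fact_dimProd) :
    U.HC_CM ∧ U.PerL44 ∧ U.PerL ∧ U.PeriodThmF ∧ U.W_RK4 :=
  have h := endState_conclusions M T E.h07 E.h09a E.h09b E.hM38 E.hAlb E.h12b E.hbr E.hQ Pc E.A12 E.A34 E.hch E.hW
  ⟨hcCM_of_endState_descentFactsB₄ M E hN1 hN2 h4 h5 hu hb hd, h.1, h.2.1, h.2.2.2.1, h.2.2.2.2.1⟩

/-- The run-27 route-(δ) statement is the special case with the redundant hypothesis `hN3`. -/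
theorem hcCM_of_endState_descentFactsB₃_eq₄ (M : U.ModelAxioms) (E : EndState T Pc)
    (hN1 : U.Fact_cupExterior) (hN2 : U.Fact_cup_hodge) (hN3 : U.Fact_pull_H0)
    (h4 : U.Fact_cupAlg) (h5 : U.Fact_cupAssoc) (hu : U.Fact_unitH0) (hb : U.Fact_gysinDescentB)
    (hd : U.Fact_dimProd) :
    hcCM_of_endState_descentFactsB₃ M E hN1 hN2 hN3 h4 h5 hu hb hd =
      hcCM_of_endState_descentFactsB₄ M E hN1 hN2 h4 h5 hu hb hd :=
  rfl

end EndStateHCCM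

/-- **`HC_CM` END TO END without N3 and N4, binders explicit, route (δ)** (audited-list form): the model axioms `M`; the
thirteen PerL-side binders in the order and with the types of `AssemblyRoutes.perL_of_openCharsWeilLeavesCRΔ`; the seven
[QW8]-side facts N1, N2, F4, F5, F-H0, F7d-B, M40.  Conclusion: `U.HC_CM`.  (Compare
`hcCM_of_openCharsWeilLeavesCRΔ_descentFacts₃`: route (γ) with N3 and F7d.) -/
theorem hcCM_of_openCharsWeilLeavesCRΔ_descentFactsB₄ {U : Universe} (M : U.ModelAxioms) (T : U.ThetaModel)
    (h07 : N07_hodgeRiemann20 U) (h09a : N09a_embCover T) (h09b : N09b_innerEmb T)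
    (hM38 : U.Fact_cmInflation) (hAlb : T.Fact_thetaAlbanese) (h12b : N12b_signRecipe T)
    (hbr : ∀ {L : CMField} {ι₁ : L →+* ℂ} (V : HermSpace3 L ι₁) (c : SeesawCtx L), T.GoodCtx ι₁ c →
      Nonempty (SeesawDictionary.SeesawBridge T V c (T.t12 V c) 0 1))
    (hQ : ∀ {L : CMField} {ι₁ : L →+* ℂ} (V : HermSpace3 L ι₁) (c : SeesawCtx L), T.GoodCtx ι₁ c →
      Nonempty (QautDictionary.QautBridge T V c (T.t34 V c) 2 3))
    (Pc : ∀ {L : CMField} {ι₁ : L →+* ℂ} (V : HermSpace3 L ι₁) (c : SeesawCtx L),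
      C4a.PointedCore (T.core V c))
    (A12 : ∀ {L : CMField} {ι₁ : L →+* ℂ} (V : HermSpace3 L ι₁) (c : SeesawCtx L),
      T.GoodCtx ι₁ c → Nonempty (ArchCDatum (T.core V c) (T.t12 V c) (Pc V c)))
    (A34 : ∀ {L : CMField} {ι₁ : L →+* ℂ} (V : HermSpace3 L ι₁) (c : SeesawCtx L),
      T.GoodCtx ι₁ c → Nonempty (ArchCDatum (T.core V c) (T.t34 V c) (Pc V c)))
    (hch : T.Open_chars) (hW : CharSpansFinal.WeilStepsInputCRΔ T)
    (hN1 : U.Fact_cupExterior) (hN2 : U.Fact_cup_hodge) (h4 : U.Fact_cupAlg) (h5 : U.Fact_cupAssoc)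
    (hu : U.Fact_unitH0) (hb : U.Fact_gysinDescentB) (hd : U.Fact_dimProd) : U.HC_CM :=
  EndStateHCCM.hcCM_of_endState_descentFactsB₄ M
    (⟨h07, h09a, h09b, hM38, hAlb, h12b, hbr, hQ, A12, A34, hch, hW⟩ : EndStateShadow.EndState T Pc)
    hN1 hN2 h4 h5 hu hb hd

end PerL34

end HodgeCM

end
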